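import Summits.QuantumFields.BalabanUV.Beta.D1BFx.PackedDressingBridgeComb

/-!
# `BalabanUV.Beta.D1BFx.PackedDressingBridgeCombFull` — road «BF-x» for binder row D1, slot (K), junction (J1) after «(J1-γ) ABSORPTION»: brick
# «PACK-BRIDGE (III′)» PART 2 — **`LocStencil₂` IS TRANSPORTED THROUGH THE ROOTED AND THE SYMMETRISED COMB ON EITHER BOND SLOT, AND THE
# SECOND-ORDER PACK-BRIDGE AT THE COMPOSITE (III′) LEG `coDressKAt ρ N (coDressKSymAt ρ N K)`** (`GcombSh n 0 = coDressKAt ρc n (coDressKSymAt ρc n (KInvStep n 0))`):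
# `vertex2OfK (coDressKAt ρ N (coDressKSymAt ρ N K)) N S₂ = vertex2OfK K N Ŝ₂`, `Ŝ₂ := (Π̂ᵀ_sbm Π̂ᵀ_sbm ∘ Πᵀ_ρ Πᵀ_ρ) S₂` (both bond slots through both projectors,
# the resolvent undressed), together with the displayed `LocStencil₂` letter of `Ŝ₂` — the S6 socket shape of the OWNER's `J1-RESIDUE-SPEC.md` v0.1 (S6′).

CONTENT (all [folklore]; in-block root `r ∈ box (d+1) N`, `1 ≤ N`, `0 ≤ δ`; every `d`):
* §1 ROOTED: `locStencil₂_coProjAtK_inner` (constant `cK d N δ · C`), `locStencil₂_coProjAtK_outer` (constant `cW (d+1) N · e^{3δ(d+1)N} · C`),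
  `locStencil₂_coProjAtK₂` (both slots).
* §2 SYMMETRISED: `locStencil₂_coProjSymAtK_inner` (`cKb d N δ · C`), `locStencil₂_coProjSymAtK_outer` (`cWb d N · e^{3δ(d+1)N} · C`), `locStencil₂_coProjSymAtK₂`.
* §3 **`vertex2OfK_coDressKAt_coDressKSymAt_eq_full`** (PART 1's two `_full` bridges chained; `decays_coDressKSymAt` for the intermediate leg) and
  **`locStencil₂_combDressed₂`** (the `LocStencil₂` letter of the fully dressed pair family, rate unchanged, constant displayed).
The window geometry is an2's (`AxialDressingRootedLegs.locStencil_coProjAtK`: `l1_le_of_mem_cube`, one triangle inequality per localisation centre).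

HONEST DEPENDENCY (cell records, verbatim): «continuum YM on T⁴ ⇐ BetaPertH ∧ nine spine estimates (0/9 proved); BetaPertH ⇐ (D1) ∧ (D4) ∧
CAP+tail; G-an2-4 gates asym, D1 and NE2/3/4.»  HONEST FRAMING (cell contract, verbatim): «discharging `BetaPertH` makes Bałaban's UV stability
UNCONDITIONAL — a real constructive-QFT result; it is NOT the continuum limit and NOT the Clay problem.»  THIS MODULE DISCHARGES NOTHING of (K),
of D1 or of the wall: [folklore] window bookkeeping BY NAME; the constants carry the dressing's `e^{O(δN)}` and `cW ∕ cWb` window factors EXPLICITLY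
(polynomial in `N` — see the leaf-03 g27 located warning W-2, journal l.46615: these are NOT n-free).  No definition, no `def … : Prop`, nothing cited,
0 sorry.  0 root-level binders of row D1 discharged; the «(J1-W) tadpole row» stays OPEN; (K) NOT closed; NOT D1, NOT `BetaPertH`, NOT continuum, NOT Clay.

ABSOLUTE RULE (cell charter, verbatim): «No internally-minted statement may enter as a cited fact. Every hypothesis is either kernel-proved in this
package or a verbatim quotation of a PUBLISHED theorem with page reference. The manuscript(s) under audit are NOT citable for their own disputed
steps — they are the thing under adjudication; programme-internal (2001/route/tribunal) claims are never citable.»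
Unit `b2b-balaban-beta-d1-formalise-leaf-03` (gen 27), D1 formalisation swarm leaf prover 03, road «BF-x»; OWNER spec S6′ (journal [D1LEAF03-G27-*]).
-/

noncomputable section

namespace Summit.QuantumFields.BalabanUV.Beta.D1BFx.PackedDressingBridgeCombFull

open scoped BigOperators
open Literature.MathematicalPhysics.QuantumFieldTheory.Balaban1983to89
open Literature.MathematicalPhysics.QuantumFieldTheory.Balaban1983to89.Beta
open B12Sec2to5 (l1 l1_nonneg)
open ExpKernelCalculus (MKer BiLoc Decays l1_sub_triangle)
open AffineAveraging (box toSite)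
open OneStepResolventKernel (Fib)
open OneStepKernelFamily (vertexOfK)
open BalabanCompositeJets (LocStencil₂)
open SecondOrderResponse (vertex2OfK)
open Summit.QuantumFields.BalabanUV.Beta.AxialDressingRooted (cube cW cWb cK cKb coProjAt coProjAtK coDressKAt abs_coProjAt_le l1_le_of_mem_cube
  coProjAtK_eval)
open Summit.QuantumFields.BalabanUV.Beta.SymmetrisedDressingLegs (coProjSymAt abs_coProjSymAt_le)
open Summit.QuantumFields.BalabanUV.Beta.SymmetrisedDressingDress (coProjSymAtK coProjSymAtK_eval)
open Summit.QuantumFields.BalabanUV.Beta.SymmetrisedDressingKernel (coDressKSymAt decays_coDressKSymAt)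
open Summit.QuantumFields.BalabanUV.Beta.D1BFx.PackedDressingBridgeComb (vertex2OfK_coDressKAt_eq_full vertex2OfK_coDressKSymAt_eq_full)

variable {d : ℕ}

/-! ## §0 Window geometry: moving a localisation centre inside the window -/

section Geometry

variable {N : ℕ}

/-- [folklore] For a window offset `v ∈ cube (d+1) N`: `−δ|p − (u+v)|₁ ≤ δ(d+1)N − δ|p − u|₁` (`0 ≤ δ`). -/
theorem neg_mul_l1_shift_le {δ : ℝ} (hδ : 0 ≤ δ) {v : Fin (d + 1) → ℤ} (hv : v ∈ cube (d + 1) N) (p u : Fin (d + 1) → ℤ) :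
    -δ * l1 (p - (u + v)) ≤ δ * (((d : ℝ) + 1) * N) - δ * l1 (p - u) := by
  have hr' : l1 ((u + v) - u) ≤ ((d : ℝ) + 1) * N := by
    rw [add_sub_cancel_left]
    have h := l1_le_of_mem_cube hv
    push_cast at h
    exact h
  have t : l1 (p - u) ≤ l1 (p - (u + v)) + l1 ((u + v) - u) := l1_sub_triangle p (u + v) u
  nlinarith

/-- [folklore] The same with the roles exchanged: `−δ|(u+v) − p|₁ ≤ δ(d+1)N − δ|u − p|₁`. -/
theorem neg_mul_l1_shift_le' {δ : ℝ} (hδ : 0 ≤ δ) {v : Fin (d + 1) → ℤ} (hv : v ∈ cube (d + 1) N) (p u : Fin (d + 1) → ℤ) :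
    -δ * l1 ((u + v) - p) ≤ δ * (((d : ℝ) + 1) * N) - δ * l1 (u - p) := by
  have h := neg_mul_l1_shift_le (N := N) hδ hv p u
  rw [ExpKernelCalculus.l1_sub_symm p (u + v), ExpKernelCalculus.l1_sub_symm p u] at h
  exact h

end Geometry

/-! ## §1 The rooted axial comb transports `LocStencil₂` on either slot -/

section Rooted

variable {N : ℕ} (hN : 1 ≤ N) {r : Fin (d + 1) → ℕ} (hr : r ∈ box (d + 1) N)
include hN hr

/-- [folklore] **INNER SLOT**: `LocStencil₂ S₂ C δ ⇒ LocStencil₂ (κ u κ′ u′ ↦ Πᵀ_ρ (S₂ κ u) κ′ u′) (cK d N δ · C) δ` — the window on the SECOND bond moves the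
separation factor `e^{−δ|u′−u|₁}` by at most `e^{δ(d+1)N}`; the bi-localisation at the first bond is untouched. -/
theorem locStencil₂_coProjAtK_inner {S₂ : Fin (d + 1) → (Fin (d + 1) → ℤ) → Fin (d + 1) → (Fin (d + 1) → ℤ) → MKer (d + 1) (Fib d)} {C δ : ℝ}
    (hS₂ : LocStencil₂ S₂ C δ) (hδ : 0 ≤ δ) :
    LocStencil₂ (fun κ u κ' u' => coProjAtK (toSite r) N (S₂ κ u) κ' u') (cK d N δ * C) δ := by
  have hC : 0 ≤ C := hS₂.nonneg
  intro κ u κ' u' x y a b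
  simp only [coProjAtK_eval]
  have hM : ∀ (κ₁ : Fin (d + 1)) (v : Fin (d + 1) → ℤ), v ∈ cube (d + 1) N →
      |S₂ κ u κ₁ (u' + v) x y a b| ≤ C * Real.exp (δ * (((d : ℝ) + 1) * N)) * Real.exp (-δ * l1 (u' - u))
        * Real.exp (-δ * (l1 (x - u) + l1 (y - u))) := by
    intro κ₁ v hv
    have h1 := neg_mul_l1_shift_le' (N := N) hδ hv u u'
    calc |S₂ κ u κ₁ (u' + v) x y a b|
        ≤ C * Real.exp (-δ * l1 ((u' + v) - u)) * Real.exp (-δ * (l1 (x - u) + l1 (y - u))) := hS₂ κ u κ₁ (u' + v) x y a b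
      _ ≤ C * (Real.exp (δ * (((d : ℝ) + 1) * N)) * Real.exp (-δ * l1 (u' - u))) * Real.exp (-δ * (l1 (x - u) + l1 (y - u))) := by
          refine mul_le_mul_of_nonneg_right (mul_le_mul_of_nonneg_left ?_ hC) (Real.exp_pos _).le
          rw [← Real.exp_add]
          exact Real.exp_le_exp.2 (by linarith)
      _ = _ := by ring
  calc |coProjAt (toSite r) N (fun κ₁ u₁ => S₂ κ u κ₁ u₁ x y a b) κ' u'|
      ≤ cW (d + 1) N * (C * Real.exp (δ * (((d : ℝ) + 1) * N)) * Real.exp (-δ * l1 (u' - u))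
          * Real.exp (-δ * (l1 (x - u) + l1 (y - u)))) := abs_coProjAt_le hN hr _ κ' u' hM
    _ = cK d N δ * C * Real.exp (-δ * l1 (u' - u)) * Real.exp (-δ * (l1 (x - u) + l1 (y - u))) := by
        unfold cK
        ring

/-- [folklore] **OUTER SLOT**: `LocStencil₂ T C δ ⇒ LocStencil₂ (κ u κ′ u′ ↦ Πᵀ_ρ^{outer} (κ₀ u₀ ↦ T κ₀ u₀ κ′ u′) κ u) (cW (d+1) N · e^{3δ(d+1)N} · C) δ` — the window on
the FIRST bond moves all three localisation centres (separation, and the two legs) by at most `(d+1)N` each. -/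
theorem locStencil₂_coProjAtK_outer {T : Fin (d + 1) → (Fin (d + 1) → ℤ) → Fin (d + 1) → (Fin (d + 1) → ℤ) → MKer (d + 1) (Fib d)} {C δ : ℝ}
    (hT : LocStencil₂ T C δ) (hδ : 0 ≤ δ) :
    LocStencil₂ (fun κ u κ' u' => coProjAtK (toSite r) N (fun κ₀ u₀ => T κ₀ u₀ κ' u') κ u)
      (cW (d + 1) N * Real.exp (3 * δ * (((d : ℝ) + 1) * N)) * C) δ := by
  have hC : 0 ≤ C := hT.nonneg
  intro κ u κ' u' x y a b
  simp only [coProjAtK_eval]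
  have hM : ∀ (κ₀ : Fin (d + 1)) (v : Fin (d + 1) → ℤ), v ∈ cube (d + 1) N →
      |T κ₀ (u + v) κ' u' x y a b| ≤ C * Real.exp (3 * δ * (((d : ℝ) + 1) * N)) * Real.exp (-δ * l1 (u' - u))
        * Real.exp (-δ * (l1 (x - u) + l1 (y - u))) := by
    intro κ₀ v hv
    have h1 := neg_mul_l1_shift_le (N := N) hδ hv u' u
    have h2 := neg_mul_l1_shift_le (N := N) hδ hv x u
    have h3 := neg_mul_l1_shift_le (N := N) hδ hv y u
    calc |T κ₀ (u + v) κ' u' x y a b|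
        ≤ C * Real.exp (-δ * l1 (u' - (u + v))) * Real.exp (-δ * (l1 (x - (u + v)) + l1 (y - (u + v)))) := hT κ₀ (u + v) κ' u' x y a b
      _ = C * Real.exp (-δ * l1 (u' - (u + v)) + -δ * (l1 (x - (u + v)) + l1 (y - (u + v)))) := by rw [mul_assoc, ← Real.exp_add]
      _ ≤ C * Real.exp (3 * δ * (((d : ℝ) + 1) * N) + -δ * l1 (u' - u) + -δ * (l1 (x - u) + l1 (y - u))) :=
          mul_le_mul_of_nonneg_left (Real.exp_le_exp.2 (by nlinarith)) hC
      _ = _ := by rw [Real.exp_add, Real.exp_add]; ring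
  calc |coProjAt (toSite r) N (fun κ₀ u₀ => T κ₀ u₀ κ' u' x y a b) κ u|
      ≤ cW (d + 1) N * (C * Real.exp (3 * δ * (((d : ℝ) + 1) * N)) * Real.exp (-δ * l1 (u' - u))
          * Real.exp (-δ * (l1 (x - u) + l1 (y - u)))) := abs_coProjAt_le hN hr _ κ u hM
    _ = cW (d + 1) N * Real.exp (3 * δ * (((d : ℝ) + 1) * N)) * C * Real.exp (-δ * l1 (u' - u))
          * Real.exp (-δ * (l1 (x - u) + l1 (y - u))) := by ring

/-- [folklore] **BOTH SLOTS** through the rooted comb: `LocStencil₂ S₂ C δ ⇒ LocStencil₂ S₂^{ΠΠ} (cW (d+1) N · e^{3δ(d+1)N} · (cK d N δ · C)) δ`. -/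
theorem locStencil₂_coProjAtK₂ {S₂ : Fin (d + 1) → (Fin (d + 1) → ℤ) → Fin (d + 1) → (Fin (d + 1) → ℤ) → MKer (d + 1) (Fib d)} {C δ : ℝ}
    (hS₂ : LocStencil₂ S₂ C δ) (hδ : 0 ≤ δ) :
    LocStencil₂ (fun κ u κ' u' => coProjAtK (toSite r) N (fun κ₀ u₀ => coProjAtK (toSite r) N (S₂ κ₀ u₀) κ' u') κ u)
      (cW (d + 1) N * Real.exp (3 * δ * (((d : ℝ) + 1) * N)) * (cK d N δ * C)) δ :=
  locStencil₂_coProjAtK_outer hN hr (locStencil₂_coProjAtK_inner hN hr hS₂ hδ) hδ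

end Rooted

/-! ## §2 The symmetrised block-mean comb transports `LocStencil₂` on either slot -/

section Sym

variable {N : ℕ} (hN : 1 ≤ N) {r : Fin (d + 1) → ℕ} (hr : r ∈ box (d + 1) N)
include hN hr

/-- [folklore] **INNER SLOT**, symmetrised comb: constant `cKb d N δ · C`. -/
theorem locStencil₂_coProjSymAtK_inner {S₂ : Fin (d + 1) → (Fin (d + 1) → ℤ) → Fin (d + 1) → (Fin (d + 1) → ℤ) → MKer (d + 1) (Fib d)} {C δ : ℝ}
    (hS₂ : LocStencil₂ S₂ C δ) (hδ : 0 ≤ δ) :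
    LocStencil₂ (fun κ u κ' u' => coProjSymAtK (toSite r) N (S₂ κ u) κ' u') (cKb d N δ * C) δ := by
  have hC : 0 ≤ C := hS₂.nonneg
  intro κ u κ' u' x y a b
  simp only [coProjSymAtK_eval]
  have hM : ∀ (κ₁ : Fin (d + 1)) (v : Fin (d + 1) → ℤ), v ∈ cube (d + 1) N →
      |S₂ κ u κ₁ (u' + v) x y a b| ≤ C * Real.exp (δ * (((d : ℝ) + 1) * N)) * Real.exp (-δ * l1 (u' - u))
        * Real.exp (-δ * (l1 (x - u) + l1 (y - u))) := by
    intro κ₁ v hv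
    have h1 := neg_mul_l1_shift_le' (N := N) hδ hv u u'
    calc |S₂ κ u κ₁ (u' + v) x y a b|
        ≤ C * Real.exp (-δ * l1 ((u' + v) - u)) * Real.exp (-δ * (l1 (x - u) + l1 (y - u))) := hS₂ κ u κ₁ (u' + v) x y a b
      _ ≤ C * (Real.exp (δ * (((d : ℝ) + 1) * N)) * Real.exp (-δ * l1 (u' - u))) * Real.exp (-δ * (l1 (x - u) + l1 (y - u))) := by
          refine mul_le_mul_of_nonneg_right (mul_le_mul_of_nonneg_left ?_ hC) (Real.exp_pos _).le
          rw [← Real.exp_add]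
          exact Real.exp_le_exp.2 (by linarith)
      _ = _ := by ring
  calc |coProjSymAt (toSite r) N (fun κ₁ u₁ => S₂ κ u κ₁ u₁ x y a b) κ' u'|
      ≤ cWb d N * (C * Real.exp (δ * (((d : ℝ) + 1) * N)) * Real.exp (-δ * l1 (u' - u))
          * Real.exp (-δ * (l1 (x - u) + l1 (y - u)))) := abs_coProjSymAt_le hN hr _ κ' u' hM
    _ = cKb d N δ * C * Real.exp (-δ * l1 (u' - u)) * Real.exp (-δ * (l1 (x - u) + l1 (y - u))) := by
        unfold cKb
        ring

/-- [folklore] **OUTER SLOT**, symmetrised comb: constant `cWb d N · e^{3δ(d+1)N} · C`. -/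
theorem locStencil₂_coProjSymAtK_outer {T : Fin (d + 1) → (Fin (d + 1) → ℤ) → Fin (d + 1) → (Fin (d + 1) → ℤ) → MKer (d + 1) (Fib d)} {C δ : ℝ}
    (hT : LocStencil₂ T C δ) (hδ : 0 ≤ δ) :
    LocStencil₂ (fun κ u κ' u' => coProjSymAtK (toSite r) N (fun κ₀ u₀ => T κ₀ u₀ κ' u') κ u)
      (cWb d N * Real.exp (3 * δ * (((d : ℝ) + 1) * N)) * C) δ := by
  have hC : 0 ≤ C := hT.nonneg
  intro κ u κ' u' x y a b
  simp only [coProjSymAtK_eval]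
  have hM : ∀ (κ₀ : Fin (d + 1)) (v : Fin (d + 1) → ℤ), v ∈ cube (d + 1) N →
      |T κ₀ (u + v) κ' u' x y a b| ≤ C * Real.exp (3 * δ * (((d : ℝ) + 1) * N)) * Real.exp (-δ * l1 (u' - u))
        * Real.exp (-δ * (l1 (x - u) + l1 (y - u))) := by
    intro κ₀ v hv
    have h1 := neg_mul_l1_shift_le (N := N) hδ hv u' u
    have h2 := neg_mul_l1_shift_le (N := N) hδ hv x u
    have h3 := neg_mul_l1_shift_le (N := N) hδ hv y u
    calc |T κ₀ (u + v) κ' u' x y a b|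
        ≤ C * Real.exp (-δ * l1 (u' - (u + v))) * Real.exp (-δ * (l1 (x - (u + v)) + l1 (y - (u + v)))) := hT κ₀ (u + v) κ' u' x y a b
      _ = C * Real.exp (-δ * l1 (u' - (u + v)) + -δ * (l1 (x - (u + v)) + l1 (y - (u + v)))) := by rw [mul_assoc, ← Real.exp_add]
      _ ≤ C * Real.exp (3 * δ * (((d : ℝ) + 1) * N) + -δ * l1 (u' - u) + -δ * (l1 (x - u) + l1 (y - u))) :=
          mul_le_mul_of_nonneg_left (Real.exp_le_exp.2 (by nlinarith)) hC
      _ = _ := by rw [Real.exp_add, Real.exp_add]; ring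
  calc |coProjSymAt (toSite r) N (fun κ₀ u₀ => T κ₀ u₀ κ' u' x y a b) κ u|
      ≤ cWb d N * (C * Real.exp (3 * δ * (((d : ℝ) + 1) * N)) * Real.exp (-δ * l1 (u' - u))
          * Real.exp (-δ * (l1 (x - u) + l1 (y - u)))) := abs_coProjSymAt_le hN hr _ κ u hM
    _ = cWb d N * Real.exp (3 * δ * (((d : ℝ) + 1) * N)) * C * Real.exp (-δ * l1 (u' - u))
          * Real.exp (-δ * (l1 (x - u) + l1 (y - u))) := by ring

/-- [folklore] **BOTH SLOTS** through the symmetrised comb. -/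
theorem locStencil₂_coProjSymAtK₂ {S₂ : Fin (d + 1) → (Fin (d + 1) → ℤ) → Fin (d + 1) → (Fin (d + 1) → ℤ) → MKer (d + 1) (Fib d)} {C δ : ℝ}
    (hS₂ : LocStencil₂ S₂ C δ) (hδ : 0 ≤ δ) :
    LocStencil₂ (fun κ u κ' u' => coProjSymAtK (toSite r) N (fun κ₀ u₀ => coProjSymAtK (toSite r) N (S₂ κ₀ u₀) κ' u') κ u)
      (cWb d N * Real.exp (3 * δ * (((d : ℝ) + 1) * N)) * (cKb d N δ * C)) δ :=
  locStencil₂_coProjSymAtK_outer hN hr (locStencil₂_coProjSymAtK_inner hN hr hS₂ hδ) hδ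

end Sym

/-! ## §3 The composite (III′) leg: both projectors, both slots -/

section Composite

variable {N : ℕ} (hN : 1 ≤ N) {r : Fin (d + 1) → ℕ} (hr : r ∈ box (d + 1) N)
include hN hr

/-- [folklore] **THE SECOND-ORDER PACK-BRIDGE AT THE COMPOSITE (III′) LEG**: for a decaying `K` and a `LocStencil₂` pair family `S₂`,
`vertex2OfK (coDressKAt ρ N (coDressKSymAt ρ N K)) N S₂ μ y ν y′ = vertex2OfK K N Ŝ₂ μ y ν y′` with
`Ŝ₂ := Π̂ᵀ_sbm^{outer} Π̂ᵀ_sbm^{inner} (Πᵀ_ρ^{outer} Πᵀ_ρ^{inner} S₂)` — PART 1's rooted bridge at the leg `coDressKSymAt ρ N K` (decaying by an2's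
`decays_coDressKSymAt`), then PART 1's symmetrised bridge at `K` on the rooted-dressed family (its `LocStencil₂` letter from §1).  At `ρ = ctr`, `K = KInvStep n 0`
the left leg is `CombChartStepJets.GcombSh n 0` (`GcombSh_apply`). -/
theorem vertex2OfK_coDressKAt_coDressKSymAt_eq_full {K : MKer (d + 1) (Fib d)} {C δ : ℝ} (hK : Decays K C δ) (hC : 0 ≤ C) (hδ : 0 < δ)
    {S₂ : Fin (d + 1) → (Fin (d + 1) → ℤ) → Fin (d + 1) → (Fin (d + 1) → ℤ) → MKer (d + 1) (Fib d)} {C₂ δ₂ : ℝ}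
    (hS₂ : LocStencil₂ S₂ C₂ δ₂) (hδ₂ : 0 < δ₂) (μ : Fin (d + 1)) (y : Fin (d + 1) → ℤ) (ν : Fin (d + 1)) (y' : Fin (d + 1) → ℤ) :
    vertex2OfK (coDressKAt (toSite r) N (coDressKSymAt (toSite r) N K)) N S₂ μ y ν y'
      = vertex2OfK K N (fun κ u κ' u' => coProjSymAtK (toSite r) N (fun κ₀ u₀ => coProjSymAtK (toSite r) N
          ((fun κ₁ u₁ κ₁' u₁' => coProjAtK (toSite r) N (fun κ₂ u₂ => coProjAtK (toSite r) N (S₂ κ₂ u₂) κ₁' u₁') κ₁ u₁) κ₀ u₀) κ' u') κ u) μ y ν y' := by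
  obtain ⟨δ', C', hδ', hC', hK'⟩ := decays_coDressKSymAt hN hr ⟨δ, C, hδ, hC, hK⟩
  rw [vertex2OfK_coDressKAt_eq_full hN hr hK' hC' hδ' hS₂ hδ₂ μ y ν y']
  exact vertex2OfK_coDressKSymAt_eq_full hN hr hK hC hδ (locStencil₂_coProjAtK₂ hN hr hS₂ hδ₂.le) hδ₂ μ y ν y'

/-- [folklore] **THE `LocStencil₂` LETTER OF THE FULLY DRESSED PAIR FAMILY `Ŝ₂`** (the S6 socket shape): rate `δ` unchanged, constant
`cWb·e^{3δ(d+1)N}·cKb·(cW·e^{3δ(d+1)N}·cK·C)` — polynomial in `N` through `cW ∕ cWb ∕ cK ∕ cKb`, displayed, NOT n-free. -/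
theorem locStencil₂_combDressed₂ {S₂ : Fin (d + 1) → (Fin (d + 1) → ℤ) → Fin (d + 1) → (Fin (d + 1) → ℤ) → MKer (d + 1) (Fib d)} {C δ : ℝ}
    (hS₂ : LocStencil₂ S₂ C δ) (hδ : 0 ≤ δ) :
    LocStencil₂ (fun κ u κ' u' => coProjSymAtK (toSite r) N (fun κ₀ u₀ => coProjSymAtK (toSite r) N
          ((fun κ₁ u₁ κ₁' u₁' => coProjAtK (toSite r) N (fun κ₂ u₂ => coProjAtK (toSite r) N (S₂ κ₂ u₂) κ₁' u₁') κ₁ u₁) κ₀ u₀) κ' u') κ u)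
      (cWb d N * Real.exp (3 * δ * (((d : ℝ) + 1) * N))
        * (cKb d N δ * (cW (d + 1) N * Real.exp (3 * δ * (((d : ℝ) + 1) * N)) * (cK d N δ * C)))) δ :=
  locStencil₂_coProjSymAtK₂ hN hr (locStencil₂_coProjAtK₂ hN hr hS₂ hδ) hδ

end Composite

end Summit.QuantumFields.BalabanUV.Beta.D1BFx.PackedDressingBridgeCombFull

end
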